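import Literature.Probability.Process.DoobMaximalIneq
import Literature.Probability.Process.ContinuousHitting
import HarnessLib

/-!
# The first-moment maximal inequality for nonnegative martingales in continuous time

Topic `Probability/Process`; theorems only. Companion of `DoobMaximalIneq.lean` (which proves the
`L²` form `μ {sup_{s ≤ t} |M s| ≥ ε} ≤ E[M_t²]/ε²`): for a **nonnegative** martingale `M` with
a.s. continuous paths indexed by `ℝ≥0` and `ε > 0`,

  `μ {ω | ∃ s ≤ t, ε ≤ M s ω} ≤ E[M_t] / ε`    (`measure_exists_le_of_martingale_nonneg`),

Doob's maximal inequality for the nonnegative submartingale `M` (Revuz–Yor (1999), Ch. II,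
Thm (1.7): `λ P[sup_t X_t ≥ λ] ≤ sup_t E[X_t⁺]`), obtained from Mathlib's discrete `maximal_ineq`
along the dyadic grids of `[0, t]` and path continuity exactly as in `DoobMaximalIneq.lean`; and
its **localized form** (`measure_exists_le_of_stoppedProcess_martingale`): if `N ≥ 0` has continuous
paths, `N₀ ≡ n₀`, and along a nondecreasing sequence of random times `ρₙ` exhausting every bounded
time interval the stopped processes `N^{ρₙ}` are martingales (a nonnegative continuous local
martingale with an explicit localizing sequence), then `μ {∃ s ≤ t, c ≤ N s} ≤ n₀ / c`. The
localized form is the shape in which Rohde–Schramm's supermartingale `ψ(u)^a F̂(z(u))` (Rohde–Schramm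
(2005), proof of Thm. 3.2, "Thus `M` is a local martingale") is consumed in the proof of their
derivative estimate Cor. 3.5.

## References

* D. Revuz, M. Yor, *Continuous Martingales and Brownian Motion* (3rd ed., 1999), Ch. II,
  Thm (1.7) and Cor. (1.6) (continuous time "by considering countable dense subsets").
* J. L. Doob, *Stochastic Processes* (1953), Ch. VII §3.
* S. Rohde, O. Schramm, *Basic properties of SLE*, Ann. of Math. 161 (2005), proof of Thm. 3.2 and
  Cor. 3.5.
-/

noncomputable section

open MeasureTheory Filter Topology Set Finset
open scoped NNReal ENNReal

namespace Literature.Probability.Process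

variable {Ω : Type*} {m : MeasurableSpace Ω} {μ : Measure Ω}

/-- **Doob's maximal inequality along a finite grid, first moment**: for a nonnegative martingale
`M` (any index preorder), a monotone sequence of times `τ` and `ε > 0`,
`ε · μ {∃ k ≤ N, ε ≤ M (τ k)} ≤ E[M (τ N)]` (Mathlib's discrete `maximal_ineq` for the nonnegative
submartingale `M (τ ·)`). Revuz–Yor (1999), Ch. II, Thm (1.7); Doob (1953). [folklore] -/
theorem maximal_ineq_grid_of_nonneg {ι : Type*} [Preorder ι] {𝓕 : Filtration ι m}
    {M : ι → Ω → ℝ} [IsFiniteMeasure μ] (hM : Martingale M 𝓕 μ) (hnn : 0 ≤ M)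
    {τ : ℕ → ι} (hτ : Monotone τ) {ε : ℝ} (hε : 0 < ε) (N : ℕ) :
    ENNReal.ofReal ε * μ {ω | ∃ k ≤ N, ε ≤ M (τ k) ω} ≤ ENNReal.ofReal (∫ ω, M (τ N) ω ∂μ) := by
  have hsub : Submartingale (fun k ↦ M (τ k)) _ μ := (hM.reindex_nat hτ).submartingale
  have hnn' : 0 ≤ fun k ω ↦ M (τ k) ω := fun k ω ↦ hnn (τ k) ω
  have h := maximal_ineq hsub hnn' (ε := ε.toNNReal) N
  have hcoe : ((ε.toNNReal : ℝ≥0) : ℝ) = ε := Real.coe_toNNReal _ hε.le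
  simp only [hcoe] at h
  have hset : {ω | ∃ k ≤ N, ε ≤ M (τ k) ω} =
      {ω | ε ≤ (range (N + 1)).sup' nonempty_range_add_one fun k ↦ M (τ k) ω} := by
    ext ω
    simp only [Set.mem_setOf_eq, Finset.le_sup'_iff, Finset.mem_range, Nat.lt_succ_iff]
  rw [hset, show ENNReal.ofReal ε = ((ε.toNNReal : ℝ≥0) : ℝ≥0∞) from rfl]
  refine h.trans (ENNReal.ofReal_le_ofReal ?_)
  exact setIntegral_le_integral (hM.integrable (τ N)) (ae_of_all _ fun ω ↦ hnn (τ N) ω)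

/-- The dyadic grid of `[0, t]`: `t · (k ∧ 2ⁿ) / 2ⁿ` is monotone in `k`, ends at `t`, stays in
`[0, t]`. [folklore] -/
private theorem dyad_aux' (t : ℝ≥0) (n : ℕ) :
    Monotone (fun k : ℕ ↦ t * ((min k (2 ^ n) : ℕ) : ℝ≥0) / 2 ^ n) ∧
    (fun k : ℕ ↦ t * ((min k (2 ^ n) : ℕ) : ℝ≥0) / 2 ^ n) (2 ^ n) = t := by
  have h2 : (0 : ℝ≥0) < 2 ^ n := pow_pos two_pos n
  refine ⟨fun k l hkl ↦ ?_, ?_⟩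
  · dsimp only
    gcongr
  · simp only [min_self, Nat.cast_pow, Nat.cast_ofNat]
    rw [mul_div_assoc, div_self h2.ne', mul_one]

/-- **Doob's maximal inequality in continuous time, first moment**: for a nonnegative martingale
`M` with a.s. continuous paths indexed by `ℝ≥0`, `ε > 0` and every `t`,
`μ {ω | ∃ s ≤ t, ε ≤ M s ω} ≤ E[M_t] / ε`. Proof: the grid inequality along the dyadic grids of
`[0, t]` (`maximal_ineq_grid_of_nonneg`), whose exceedance events increase with the level of the
grid and, for every `ε' < ε`, eventually contain `{∃ s ≤ t, ε ≤ M s}` on continuous paths; then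
`ε' ↑ ε`. Revuz–Yor (1999), Ch. II, Thm (1.7); Doob (1953). [folklore] -/
theorem measure_exists_le_of_martingale_nonneg {𝓕 : Filtration ℝ≥0 m} {M : ℝ≥0 → Ω → ℝ}
    [IsFiniteMeasure μ] (hM : Martingale M 𝓕 μ) (hnn : 0 ≤ M)
    (hcont : ∀ᵐ ω ∂μ, Continuous (M · ω)) {ε : ℝ} (hε : 0 < ε) (t : ℝ≥0) :
    μ {ω | ∃ s ≤ t, ε ≤ M s ω} ≤ ENNReal.ofReal ((∫ ω, M t ω ∂μ) / ε) := by
  set C : ℝ := ∫ ω, M t ω ∂μ with hC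
  have hC0 : 0 ≤ C := integral_nonneg fun ω ↦ hnn t ω
  -- the dyadic grids and their exceedance events
  let τ : ℕ → ℕ → ℝ≥0 := fun n k ↦ t * ((min k (2 ^ n) : ℕ) : ℝ≥0) / 2 ^ n
  let A : ℝ → ℕ → Set Ω := fun e n ↦ {ω | ∃ k ≤ 2 ^ n, e ≤ M (τ n k) ω}
  -- Step 1: the discrete bound on each grid
  have hgrid : ∀ {e : ℝ}, 0 < e → ∀ n, μ (A e n) ≤ ENNReal.ofReal (C / e) := by
    intro e he n
    obtain ⟨hmono, hlast⟩ := dyad_aux' t n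
    have h := maximal_ineq_grid_of_nonneg hM hnn hmono he (2 ^ n)
    have hlast' : M (τ n (2 ^ n)) = M t := by
      show M ((fun k : ℕ ↦ t * ((min k (2 ^ n) : ℕ) : ℝ≥0) / 2 ^ n) (2 ^ n)) = M t
      rw [hlast]
    rw [hlast'] at h
    rw [ENNReal.ofReal_div_of_pos he]
    refine (ENNReal.le_div_iff_mul_le (Or.inl ((ENNReal.ofReal_pos.2 he).ne'))
      (Or.inl ENNReal.ofReal_ne_top)).2 ?_
    rw [mul_comm]
    exact h
  -- Step 2: the grids refine: `A e n ⊆ A e (n + 1)`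
  have hAmono : ∀ e, Monotone (A e) := by
    intro e
    refine monotone_nat_of_le_succ fun n ↦ ?_
    rintro ω ⟨k, hk, hek⟩
    refine ⟨2 * k, by rw [pow_succ]; omega, ?_⟩
    have : τ (n + 1) (2 * k) = τ n k := by
      show t * ((min (2 * k) (2 ^ (n + 1)) : ℕ) : ℝ≥0) / 2 ^ (n + 1) =
        t * ((min k (2 ^ n) : ℕ) : ℝ≥0) / 2 ^ n
      rw [min_eq_left hk, min_eq_left (by rw [pow_succ]; omega)]
      push_cast
      rw [pow_succ]
      field_simp
    rw [this]
    exact hek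
  -- Step 3: on continuous paths, `{∃ s ≤ t, ε ≤ M s} ⊆ ⋃ n, A e n` for every `e < ε`
  have hcover : ∀ {e : ℝ}, e < ε → ∀ ω, Continuous (M · ω) → (∃ s ≤ t, ε ≤ M s ω) →
      ω ∈ ⋃ n, A e n := by
    intro e heε ω hω ⟨s, hst, hεs⟩
    have hopen : IsOpen {r : ℝ≥0 | e < M r ω} := isOpen_lt continuous_const hω
    have hs_mem : s ∈ {r : ℝ≥0 | e < M r ω} := heε.trans_le hεs
    obtain ⟨δ, hδ, hball⟩ := Metric.isOpen_iff.1 hopen s hs_mem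
    rcases eq_or_ne t 0 with ht0 | ht0
    · refine Set.mem_iUnion.2 ⟨0, 0, Nat.zero_le _, ?_⟩
      have hs0 : s = 0 := nonpos_iff_eq_zero.1 (ht0 ▸ hst)
      have : τ 0 0 = s := by
        show t * ((min 0 (2 ^ 0) : ℕ) : ℝ≥0) / 2 ^ 0 = s
        simp [hs0]
      rw [this]
      exact heε.le.trans hεs
    · have ht0 : 0 < t := pos_iff_ne_zero.2 ht0
      obtain ⟨n, hn⟩ : ∃ n : ℕ, (t : ℝ) / 2 ^ n < δ := by
        obtain ⟨n, hn⟩ := exists_nat_gt ((t : ℝ) / δ)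
        refine ⟨n, ?_⟩
        have h2n : (n : ℝ) < 2 ^ n := by exact_mod_cast Nat.lt_two_pow_self
        rw [div_lt_iff₀ (by positivity)]
        calc (t : ℝ) = (t : ℝ) / δ * δ := by field_simp
          _ < n * δ := by gcongr
          _ < 2 ^ n * δ := by gcongr
          _ = δ * 2 ^ n := mul_comm _ _
      refine Set.mem_iUnion.2 ⟨n, ?_⟩
      have htpos : (0 : ℝ) < t := by exact_mod_cast ht0
      have h2pos : (0 : ℝ) < 2 ^ n := by positivity
      have hst' : (s : ℝ) ≤ t := by exact_mod_cast hst
      set k : ℕ := ⌊(s : ℝ) * 2 ^ n / t⌋₊ with hk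
      have hx : (s : ℝ) * 2 ^ n / t ≤ (2 ^ n : ℕ) := by
        push_cast
        rw [div_le_iff₀ htpos]
        nlinarith
      have hk_le : k ≤ 2 ^ n := Nat.floor_le_of_le hx
      refine ⟨k, hk_le, le_of_lt (hball ?_)⟩
      rw [Metric.mem_ball, NNReal.dist_eq]
      have hτ : ((τ n k : ℝ≥0) : ℝ) = (t : ℝ) * k / 2 ^ n := by
        show ((t * ((min k (2 ^ n) : ℕ) : ℝ≥0) / 2 ^ n : ℝ≥0) : ℝ) = (t : ℝ) * k / 2 ^ n
        rw [min_eq_left hk_le]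
        push_cast
        ring
      rw [hτ]
      have hfl1 : (k : ℝ) ≤ (s : ℝ) * 2 ^ n / t := Nat.floor_le (by positivity)
      have hfl2 : (s : ℝ) * 2 ^ n / t < k + 1 := Nat.lt_floor_add_one _
      have h1 : (t : ℝ) * k ≤ s * 2 ^ n := by
        have := (le_div_iff₀ htpos).1 hfl1
        linarith
      have h2 : (s : ℝ) * 2 ^ n < t * k + t := by
        have := (div_lt_iff₀ htpos).1 hfl2
        linarith
      rw [abs_sub_lt_iff]
      constructor
      · have : (t : ℝ) * k / 2 ^ n ≤ s := by
          rw [div_le_iff₀ h2pos]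
          exact h1
        linarith
      · have : (s : ℝ) - (t : ℝ) * k / 2 ^ n < (t : ℝ) / 2 ^ n := by
          have e1 : (s : ℝ) < (t * k + t) / 2 ^ n := by
            rw [lt_div_iff₀ h2pos]
            exact h2
          have e2 : ((t : ℝ) * k + t) / 2 ^ n = (t : ℝ) * k / 2 ^ n + t / 2 ^ n := by ring
          linarith
        linarith
  -- Step 4: assemble, for each `e ∈ (0, ε)`
  have hbound : ∀ {e : ℝ}, 0 < e → e < ε →
      μ {ω | ∃ s ≤ t, ε ≤ M s ω} ≤ ENNReal.ofReal (C / e) := by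
    intro e he heε
    have hsub : {ω | ∃ s ≤ t, ε ≤ M s ω} ⊆ (⋃ n, A e n) ∪ {ω | ¬ Continuous (M · ω)} := by
      intro ω hω
      by_cases hc : Continuous (M · ω)
      · exact Or.inl (hcover heε ω hc hω)
      · exact Or.inr hc
    have hnull : μ {ω | ¬ Continuous (M · ω)} = 0 := ae_iff.1 hcont
    calc μ {ω | ∃ s ≤ t, ε ≤ M s ω}
        ≤ μ ((⋃ n, A e n) ∪ {ω | ¬ Continuous (M · ω)}) := measure_mono hsub
      _ ≤ μ (⋃ n, A e n) + μ {ω | ¬ Continuous (M · ω)} := measure_union_le _ _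
      _ = μ (⋃ n, A e n) := by rw [hnull, add_zero]
      _ ≤ ENNReal.ofReal (C / e) := by
          have hlim := tendsto_measure_iUnion_atTop (μ := μ) (hAmono e)
          exact le_of_tendsto' hlim fun n ↦ hgrid he n
  -- Step 5: let `e ↑ ε`
  have hlim : Tendsto (fun j : ℕ ↦ ENNReal.ofReal (C / (ε * (1 - 1 / ((j : ℝ) + 2)))))
      atTop (𝓝 (ENNReal.ofReal (C / ε))) := by
    refine ENNReal.tendsto_ofReal (Tendsto.div tendsto_const_nhds ?_ hε.ne')
    have h1 : Tendsto (fun j : ℕ ↦ 1 - 1 / ((j : ℝ) + 2)) atTop (𝓝 (1 - 0)) := by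
      refine tendsto_const_nhds.sub ?_
      have := tendsto_one_div_add_atTop_nhds_zero_nat (𝕜 := ℝ)
      refine (this.comp (tendsto_add_atTop_nat 1)).congr fun j ↦ ?_
      simp only [Function.comp_apply, Nat.cast_add, Nat.cast_one]
      ring
    simpa using tendsto_const_nhds.mul h1
  refine ge_of_tendsto' hlim fun j ↦ hbound ?_ ?_
  · have : (0 : ℝ) < 1 - 1 / ((j : ℝ) + 2) := by
      rw [sub_pos, div_lt_one (by positivity)]
      linarith [j.cast_nonneg (α := ℝ)]
    positivity
  · have : 1 - 1 / ((j : ℝ) + 2) < 1 := by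
      rw [sub_lt_self_iff]
      positivity
    calc ε * (1 - 1 / ((j : ℝ) + 2)) < ε * 1 := by gcongr
      _ = ε := mul_one ε

/-! ### The localized form -/

/-- The stopped clock stays before the stopping level: `↑((s ∧ c)⁻) ≤ c` (a private copy of
`Literature.Probability.Process.coe_untopA_min_le` of `LevyCharacterisation.lean`, to keep the
imports light). [folklore] -/
private theorem coe_untopA_min_le' (s : ℝ≥0) (c : WithTop ℝ≥0) :
    ((min (s : WithTop ℝ≥0) c).untopA : WithTop ℝ≥0) ≤ c := by
  induction c with
  | top => exact le_top
  | coe T => rw [untopA_min_coe_coe, WithTop.coe_le_coe]; exact min_le_right _ _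

/-- **Maximal inequality for a localized nonnegative martingale.** Let `N ≥ 0` have continuous
paths and start at the constant `n₀`, and let `ρₙ` be random times, nondecreasing in `n`, such
that every bounded time interval is eventually covered (`∀ ω t, ∃ n, t ≤ ρₙ(ω)`) and every stopped
process `N^{ρₙ}` is a martingale. Then for `c > 0` and every `t`,
`μ {ω | ∃ s ≤ t, c ≤ N s ω} ≤ n₀ / c` (on a probability space). Proof: the events
`{∃ s ≤ t, c ≤ N^{ρₙ}_s}` increase with `n` to a superset of `{∃ s ≤ t, c ≤ N_s}`, and each has
probability `≤ E[N^{ρₙ}_t]/c = E[N^{ρₙ}_0]/c = n₀/c` (`measure_exists_le_of_martingale_nonneg`).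
This is how a nonnegative continuous local martingale `M` with `M₀ = n₀` satisfies
`P[sup_{s≤t} M_s ≥ c] ≤ n₀/c` (Revuz–Yor (1999), Ch. II, Thm (1.7) with Fatou; Rohde–Schramm (2005),
proof of Thm. 3.2 / Cor. 3.5). [folklore] -/
theorem measure_exists_le_of_stoppedProcess_martingale {𝓕 : Filtration ℝ≥0 m}
    [IsProbabilityMeasure μ] {N : ℝ≥0 → Ω → ℝ} (hnn : 0 ≤ N) (hNc : ∀ ω, Continuous (N · ω))
    {n₀ : ℝ} (h0 : ∀ ω, N 0 ω = n₀) {ρ : ℕ → Ω → WithTop ℝ≥0} (hmono : ∀ ω, Monotone fun n ↦ ρ n ω)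
    (hexh : ∀ ω (t : ℝ≥0), ∃ n, (t : WithTop ℝ≥0) ≤ ρ n ω)
    (hmart : ∀ n, Martingale (stoppedProcess N (ρ n)) 𝓕 μ) {c : ℝ} (hc : 0 < c) (t : ℝ≥0) :
    μ {ω | ∃ s ≤ t, c ≤ N s ω} ≤ ENNReal.ofReal (n₀ / c) := by
  let E : ℕ → Set Ω := fun n ↦ {ω | ∃ s ≤ t, c ≤ stoppedProcess N (ρ n) s ω}
  -- each stopped event has probability `≤ n₀ / c`
  have hE : ∀ n, μ (E n) ≤ ENNReal.ofReal (n₀ / c) := by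
    intro n
    have h1 := measure_exists_le_of_martingale_nonneg (hmart n)
      (fun s ω ↦ show (0 : ℝ) ≤ stoppedProcess N (ρ n) s ω from hnn _ ω)
      (ae_of_all _ fun ω ↦ continuous_stoppedProcess_path (hNc ω) (ρ n)) hc t
    have hint : ∫ ω, stoppedProcess N (ρ n) t ω ∂μ = n₀ := by
      have h2 := (hmart n).setIntegral_eq (zero_le : (0 : ℝ≥0) ≤ t) (MeasurableSet.univ (m := 𝓕 0))
      rw [Measure.restrict_univ] at h2
      rw [← h2]
      have h3 : ∀ ω, stoppedProcess N (ρ n) 0 ω = n₀ := fun ω ↦ by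
        rw [stoppedProcess_eq_of_le (bot_le.trans_eq' rfl), h0 ω]
      simp only [h3, integral_const, probReal_univ, smul_eq_mul, one_mul]
    rwa [hint] at h1
  -- they increase with `n`
  have hEmono : Monotone E := by
    refine monotone_nat_of_le_succ fun n ↦ ?_
    rintro ω ⟨s, hst, hcs⟩
    set s' : ℝ≥0 := (min (s : WithTop ℝ≥0) (ρ n ω)).untopA with hs'
    refine ⟨s', (untopA_min_coe_le s (ρ n ω)).trans hst, ?_⟩
    have hle : (s' : WithTop ℝ≥0) ≤ ρ (n + 1) ω :=
      (coe_untopA_min_le' s (ρ n ω)).trans (hmono ω (Nat.le_succ n))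
    rw [stoppedProcess_eq_of_le hle]
    exact hcs
  -- and cover the unstopped event
  have hcover : {ω | ∃ s ≤ t, c ≤ N s ω} ⊆ ⋃ n, E n := by
    rintro ω ⟨s, hst, hcs⟩
    obtain ⟨n, hn⟩ := hexh ω t
    refine Set.mem_iUnion.2 ⟨n, s, hst, ?_⟩
    rw [stoppedProcess_eq_of_le ((WithTop.coe_le_coe.2 hst).trans hn)]
    exact hcs
  calc μ {ω | ∃ s ≤ t, c ≤ N s ω} ≤ μ (⋃ n, E n) := measure_mono hcover
    _ ≤ ENNReal.ofReal (n₀ / c) :=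
        le_of_tendsto' (tendsto_measure_iUnion_atTop (μ := μ) hEmono) hE

end Literature.Probability.Process
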